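import Summits.CriticalPhenomena.Ising3DConformalLimit.Theorems.HyperoctahedralRPExistsScaleCovariantLimitUniquenessItemMaps
import Summits.CriticalPhenomena.Ising3DConformalLimit.Theorems.HyperoctahedralRPExistsScaleCovariantLimitCompactnessItemMapsDoubling
import Summits.CriticalPhenomena.Ising3DConformalLimit.Theorems.HyperoctahedralRPExistsScaleCovariantLimitIntConvergenceOfZoomMonotone
import Summits.CriticalPhenomena.Ising3DConformalLimit.Theorems.HyperoctahedralRPExistsScaleCovariantLimitIntConfigBounded
import Summits.CriticalPhenomena.Ising3DConformalLimit.Theorems.MonotoneRGZoomGlue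
import Summits.CriticalPhenomena.Ising3DConformalLimit.Theorems.HyperoctahedralRPExistsScaleCovariantLimitPairZoomTendstoOfTwoPointLaw
import Literature.Probability.LatticeModels.CriticalUrsellFourSign
import HarnessLib

/-!
# Lattice forms of the crux `ExistsScaleCovariantLimit` and the crux from items 6150 ∧ 14454, IMPORTABLE
(line `Sketch`, crux item stmt-CriticalPhenomena-1981, route `HyperoctahedralRP`; registered anchor `stub_latticeFormsItemMaps`; lead c5,
2026-08-16)

Compositions of landed modules only (UniquenessItemMaps p120217, CompactnessItemMapsDoubling p120504, IB p108182, GZ p106934, the `MonotoneRGZoomGlue`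
monotone-bounded and geometric-mesh lemmas) — by-products of the registered skeleton `Cruxes/ExistsScaleCovariantLimit/Lines/Sketch.lean` (v8–v14) made importable:
* `crux_iff_orbitPrecompact_intMeshConvergence` — **crux ⟺ item 5955 ∧ [for every `n` and every non-coincident `y ∈ (ℤ³)ⁿ` the sequence
  `m ↦ ⟨∏ᵢσ_{m yᵢ}⟩_{β_c}/⟨σ₀σ_{m e₀}⟩_{β_c}^{n/2}` converges]** — the single cleanest lattice form of the uniqueness half (no floors: at mesh
  `1/m` the lattice points are `m yᵢ` exactly); `crux_iff_orbitPrecompact_fullFilterIntConvergence` — the full filter is needed at INTEGER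
  configurations only;
* `intMeshConvergence_of_zoomMonotone`, `dyadicIntConvergence_of_zoomMonotone`, `triadicIntConvergence_of_zoomMonotone` — **item 14454
  `ZoomMonotone` ALONE ⟹ S2' ∧ S3'** (boundedness at integer configurations is free, IB); `crux_iff_orbitPrecompact_of_zoomMonotone` —
  under 14454 the crux is EXACTLY item 5955;
* with F5 (p120021): `crux_iff_doubling_dyadicInt_triadicInt` — **crux ⟺ item 6150 ∧ S2' ∧ S3'**; `crux_iff_doubling_intMeshConvergence`;
  `crux_of_doubling_zoomMonotone` — **items 6150 ∧ 14454 ⟹ crux**: route `MonotoneRG`'s target from two LATTICE statements about explicit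
  critical correlator ratios (all-scale axis doubling + eventual monotonicity of the integer-mesh zoom), improving the landed `zoomGlue_proof`
  (item 14455: 4658 ∧ 14454 ⟹ crux) and `pinnedLimit_of_orbitPrecompact_zoomMonotone` (5955 ∧ 14454); `crux_iff_doubling_of_zoomMonotone`;
* `lowOrders_of_twoPointLaw`, `crux_iff_evenGeFour_of_twoPointLaw` — **under item 0634 the crux is S2' ∧ S3' at EVEN orders `n ≥ 4` ONLY** (orders `0`,
  odd and `2` converge along every mesh sequence: T2 p117127, `criticalCorr_eq_zero_of_odd`) — the interacting-uniqueness core (= crux 1344's residue 6′);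
* `stub_latticeFormsItemMaps` — the registered package.

References: H. Duminil-Copin, ICM 2022 §8.4 p. 29 [DuminilCopinICM2022]; M. Aizenman, H. Duminil-Copin, Ann. Math. 194 (2021) Remark 5.10
[AizenmanDuminilCopinAnnals2021]. No definitions, no `sorry`.
-/

noncomputable section

namespace Summit.CriticalPhenomena.Ising3DConformalLimit.Cruxes.ExistsScaleCovariantLimit.TwoHierarchies.ItemMaps

open Literature.Probability.LatticeModels Filter Set
open scoped Topology
open Summit.CriticalPhenomena.Ising3DConformalLimit.MoebiusLimitExistsOnlyInteraction (rhoPin)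
open Summit.CriticalPhenomena.Ising3DConformalLimit.ExistsScaleCovariantLimitNegative.Dyadic (tendsto_dyad)
open Summit.CriticalPhenomena.Ising3DConformalLimit.Cruxes.ExistsScaleCovariantLimit.TwoHierarchies
open Summit.CriticalPhenomena.Ising3DConformalLimit.Theses
open Summit.CriticalPhenomena.Ising3DConformalLimit.MonotoneRGZoomGlue
  (tendsto_of_eventually_monotone_of_bounded tendsto_one_div_natCast tendsto_geomMesh_of_intMesh)

/-! ## Bookkeeping -/

/-- Integer-mesh convergence at integer configurations gives S2' and S3' (the subsequences `m = 2^k, 3^k`). [folklore] -/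
theorem dyadicInt_triadicInt_of_intMeshConvergence
    (hint : ∀ (n : ℕ) (y : Fin n → EuclideanSpace ℝ (Fin 3)), y ∈ NonCoincident 3 n →
      (∀ i j, ∃ z : ℤ, y i j = (z : ℝ)) →
      ∃ L : ℝ, Tendsto (fun m : ℕ => rescaledCorrelator (criticalCorr 3) rhoPin n (1 / (m:ℝ)) y) atTop (𝓝 L)) :
    (∀ (n : ℕ) (y : Fin n → EuclideanSpace ℝ (Fin 3)), y ∈ NonCoincident 3 n →
      (∀ i j, ∃ z : ℤ, y i j = (z : ℝ)) →
      ∃ L : ℝ, Tendsto (fun k : ℕ => rescaledCorrelator (criticalCorr 3) rhoPin n (((2:ℝ) ^ k)⁻¹) y)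
        atTop (𝓝 L)) ∧
    (∀ (n : ℕ) (y : Fin n → EuclideanSpace ℝ (Fin 3)), y ∈ NonCoincident 3 n →
      (∀ i j, ∃ z : ℤ, y i j = (z : ℝ)) →
      ∃ L : ℝ, Tendsto (fun k : ℕ => rescaledCorrelator (criticalCorr 3) rhoPin n (((3:ℝ) ^ k)⁻¹) y)
        atTop (𝓝 L)) := by
  refine ⟨fun n y hy hi => ?_, fun n y hy hi => ?_⟩
  · obtain ⟨L, hL⟩ := hint n y hy hi
    have h := tendsto_geomMesh_of_intMesh (b := 2) le_rfl (g := fun δ => rescaledCorrelator (criticalCorr 3) rhoPin n δ y) hL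
    simp only [natCast_two_eq] at h
    exact ⟨L, h⟩
  · obtain ⟨L, hL⟩ := hint n y hy hi
    have h := tendsto_geomMesh_of_intMesh (b := 3) (by norm_num) (g := fun δ => rescaledCorrelator (criticalCorr 3) rhoPin n δ y) hL
    simp only [natCast_three_eq] at h
    exact ⟨L, h⟩

/-! ## The crux in lattice form -/

/-- **THE CRUX IS TIGHTNESS ∧ INTEGER-MESH CONVERGENCE AT INTEGER CONFIGURATIONS.** `ExistsScaleCovariantLimit ⟺ OrbitPrecompact (item 5955) ∧
[for every n and every non-coincident y ∈ (ℤ³)ⁿ the sequence m ↦ ⟨∏ᵢ σ_{m yᵢ}⟩_{β_c} / ⟨σ₀σ_{m e₀}⟩_{β_c}^{n/2} converges as m → ∞ through the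
integers]`. `⟹`: the full filter contains `1/m → 0⁺`; `⟸`: the subsequences `m = 2^k, 3^k` give S2', S3' (`crux_iff_orbitPrecompact_dyadicInt_triadicInt`).
Compare item 14454 `ZoomMonotone`: eventual MONOTONICITY of the same sequences. [cite: DuminilCopinICM2022, §8.4 p. 29] -/
theorem crux_iff_orbitPrecompact_intMeshConvergence :
    HyperoctahedralRP.ExistsScaleCovariantLimit ↔
    (MonotoneRG.OrbitPrecompact ∧
    (∀ (n : ℕ) (y : Fin n → EuclideanSpace ℝ (Fin 3)), y ∈ NonCoincident 3 n →
      (∀ i j, ∃ z : ℤ, y i j = (z : ℝ)) →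
      ∃ L : ℝ, Tendsto (fun m : ℕ => rescaledCorrelator (criticalCorr 3) rhoPin n (1 / (m:ℝ)) y) atTop (𝓝 L))) := by
  constructor
  · intro h
    refine ⟨orbitPrecompact_of_crux h, ?_⟩
    obtain ⟨S₀, hlim⟩ :=
      Summit.CriticalPhenomena.Ising3DConformalLimit.ExistsScaleCovariantLimitNegative.pinnedLimit_of_crux h
    intro n y hy _
    exact ⟨S₀ n y, ((hlim n).tendsto_at hy).comp tendsto_one_div_natCast⟩
  · rintro ⟨h1, hint⟩
    obtain ⟨h2, h3⟩ := dyadicInt_triadicInt_of_intMeshConvergence hint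
    exact crux_iff_orbitPrecompact_dyadicInt_triadicInt.2 ⟨h1, h2, h3⟩

/-- **THE CRUX IS TIGHTNESS ∧ FULL-FILTER CONVERGENCE AT INTEGER CONFIGURATIONS**: between the integer-mesh form and item 6153 (all
configurations). [cite: DuminilCopinICM2022, §8.4 p. 29] -/
theorem crux_iff_orbitPrecompact_fullFilterIntConvergence :
    HyperoctahedralRP.ExistsScaleCovariantLimit ↔
    (MonotoneRG.OrbitPrecompact ∧
    (∀ (n : ℕ) (y : Fin n → EuclideanSpace ℝ (Fin 3)), y ∈ NonCoincident 3 n →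
      (∀ i j, ∃ z : ℤ, y i j = (z : ℝ)) →
      ∃ L : ℝ, Tendsto (fun δ : ℝ => rescaledCorrelator (criticalCorr 3) rhoPin n δ y) (𝓝[>] (0:ℝ)) (𝓝 L))) := by
  constructor
  · intro h
    refine ⟨orbitPrecompact_of_crux h, ?_⟩
    obtain ⟨S₀, hlim⟩ :=
      Summit.CriticalPhenomena.Ising3DConformalLimit.ExistsScaleCovariantLimitNegative.pinnedLimit_of_crux h
    intro n y hy _
    exact ⟨S₀ n y, (hlim n).tendsto_at hy⟩
  · rintro ⟨h1, h⟩
    exact crux_iff_orbitPrecompact_dyadicInt_triadicInt.2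
      ⟨h1, fun n y hy hi => (h n y hy hi).imp fun _ hL => hL.comp tendsto_dyad,
        fun n y hy hi => (h n y hy hi).imp fun _ hL => hL.comp tendsto_triad_nhdsGT⟩

/-! ## Item 14454 `ZoomMonotone` alone gives the uniqueness half -/

/-- **Item 14454 ALONE ⟹ integer-mesh convergence at integer configurations**: an eventually monotone sequence converges once bounded, and at
INTEGER configurations the pinned zoom is bounded for free (IB `stub_intConfigBounded`: Griffiths + Newman's Gaussian inequality + MMS).
[cite: AizenmanDuminilCopinAnnals2021, arXiv:1912.07973 §5] -/
theorem intMeshConvergence_of_zoomMonotone (hZM : MonotoneRG.ZoomMonotone) :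
    ∀ (n : ℕ) (y : Fin n → EuclideanSpace ℝ (Fin 3)), y ∈ NonCoincident 3 n →
      (∀ i j, ∃ z : ℤ, y i j = (z : ℝ)) →
      ∃ L : ℝ, Tendsto (fun m : ℕ => rescaledCorrelator (criticalCorr 3) rhoPin n (1 / (m:ℝ)) y) atTop (𝓝 L) := by
  -- adapted from the skeleton `Lines/Sketch.lean` v8 (`intConvergence_of_zoomMonotone'`, lead c2)
  intro n y hy hint
  obtain ⟨m₀, hmono⟩ := hZM n y hy hint
  have hρ : (fun δ : ℝ => (criticalTwoPoint 3 (Pi.single 0 ⌊δ⁻¹⌋)) ^ (-(1/2:ℝ))) = rhoPin :=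
    funext fun δ => by simp only [rhoPin, one_div]
  rw [hρ] at hmono
  obtain ⟨M, hM⟩ := stub_intConfigBounded n y hy hint
  exact tendsto_of_eventually_monotone_of_bounded hmono hM

/-- **Item 14454 ALONE ⟹ S2'.** [folklore] -/
theorem dyadicIntConvergence_of_zoomMonotone (hZM : MonotoneRG.ZoomMonotone) :
    ∀ (n : ℕ) (y : Fin n → EuclideanSpace ℝ (Fin 3)), y ∈ NonCoincident 3 n →
      (∀ i j, ∃ z : ℤ, y i j = (z : ℝ)) →
      ∃ L : ℝ, Tendsto (fun k : ℕ => rescaledCorrelator (criticalCorr 3) rhoPin n (((2:ℝ) ^ k)⁻¹) y)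
        atTop (𝓝 L) :=
  (dyadicInt_triadicInt_of_intMeshConvergence (intMeshConvergence_of_zoomMonotone hZM)).1

/-- **Item 14454 ALONE ⟹ S3'.** [folklore] -/
theorem triadicIntConvergence_of_zoomMonotone (hZM : MonotoneRG.ZoomMonotone) :
    ∀ (n : ℕ) (y : Fin n → EuclideanSpace ℝ (Fin 3)), y ∈ NonCoincident 3 n →
      (∀ i j, ∃ z : ℤ, y i j = (z : ℝ)) →
      ∃ L : ℝ, Tendsto (fun k : ℕ => rescaledCorrelator (criticalCorr 3) rhoPin n (((3:ℝ) ^ k)⁻¹) y)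
        atTop (𝓝 L) :=
  (dyadicInt_triadicInt_of_intMeshConvergence (intMeshConvergence_of_zoomMonotone hZM)).2

/-- **Under item 14454 the crux is EXACTLY item 5955** (`OrbitPrecompact`). [cite: DuminilCopinICM2022, §8.4 p. 29] -/
theorem crux_iff_orbitPrecompact_of_zoomMonotone (hZM : MonotoneRG.ZoomMonotone) :
    HyperoctahedralRP.ExistsScaleCovariantLimit ↔ MonotoneRG.OrbitPrecompact := by
  rw [crux_iff_orbitPrecompact_intMeshConvergence]
  exact ⟨fun h => h.1, fun h => ⟨h, intMeshConvergence_of_zoomMonotone hZM⟩⟩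

/-! ## With F5: the crux from items 6150 ∧ S2' ∧ S3', and from items 6150 ∧ 14454 -/

/-- **crux ⟺ item 6150 ∧ S2' ∧ S3'**: existence of the scale-covariant continuum limit of the critical `ℤ³` Ising correlators is all-scale axis
doubling of the two-point function plus the dyadic and triadic integer-configuration convergences (`orbitPrecompact_iff_doubling`, F5 p120021).
[cite: DuminilCopinICM2022, §8.4 p. 29] -/
theorem crux_iff_doubling_dyadicInt_triadicInt :
    HyperoctahedralRP.ExistsScaleCovariantLimit ↔
    (MirrorHoelderCompactness.TwoPointDoubling ∧
    (∀ (n : ℕ) (y : Fin n → EuclideanSpace ℝ (Fin 3)), y ∈ NonCoincident 3 n →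
      (∀ i j, ∃ z : ℤ, y i j = (z : ℝ)) →
      ∃ L : ℝ, Tendsto (fun k : ℕ => rescaledCorrelator (criticalCorr 3) rhoPin n (((2:ℝ) ^ k)⁻¹) y)
        atTop (𝓝 L)) ∧
    (∀ (n : ℕ) (y : Fin n → EuclideanSpace ℝ (Fin 3)), y ∈ NonCoincident 3 n →
      (∀ i j, ∃ z : ℤ, y i j = (z : ℝ)) →
      ∃ L : ℝ, Tendsto (fun k : ℕ => rescaledCorrelator (criticalCorr 3) rhoPin n (((3:ℝ) ^ k)⁻¹) y)
        atTop (𝓝 L))) := by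
  rw [crux_iff_orbitPrecompact_dyadicInt_triadicInt, orbitPrecompact_iff_doubling]

/-- **crux ⟺ item 6150 ∧ integer-mesh convergence at integer configurations** — the crux as two statements about explicit ratios of critical
`ℤ³` Ising correlators: `κ g(m) ≤ g(2m)` and convergence of `⟨∏ᵢσ_{m yᵢ}⟩/g(m)^{n/2}`. [cite: DuminilCopinICM2022, §8.4 p. 29] -/
theorem crux_iff_doubling_intMeshConvergence :
    HyperoctahedralRP.ExistsScaleCovariantLimit ↔
    (MirrorHoelderCompactness.TwoPointDoubling ∧
    (∀ (n : ℕ) (y : Fin n → EuclideanSpace ℝ (Fin 3)), y ∈ NonCoincident 3 n →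
      (∀ i j, ∃ z : ℤ, y i j = (z : ℝ)) →
      ∃ L : ℝ, Tendsto (fun m : ℕ => rescaledCorrelator (criticalCorr 3) rhoPin n (1 / (m:ℝ)) y) atTop (𝓝 L))) := by
  rw [crux_iff_orbitPrecompact_intMeshConvergence, orbitPrecompact_iff_doubling]

/-- **Items 6150 ∧ 14454 ⟹ crux**: all-scale axis doubling of the critical two-point function and eventual monotonicity of the integer-mesh pinned zoom
at integer configurations give the scale-covariant continuum limit of ALL critical `ℤ³` Ising correlators — route `MonotoneRG`'s target from two
LATTICE statements (improves the landed `zoomGlue_proof`, item 14455: 4658 ∧ 14454 ⟹ crux). [cite: DuminilCopinICM2022, §8.4 p. 29] -/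
theorem crux_of_doubling_zoomMonotone (hD : MirrorHoelderCompactness.TwoPointDoubling) (hZM : MonotoneRG.ZoomMonotone) :
    HyperoctahedralRP.ExistsScaleCovariantLimit :=
  crux_iff_doubling_intMeshConvergence.2 ⟨hD, intMeshConvergence_of_zoomMonotone hZM⟩

/-- **Under item 14454 the crux is EXACTLY item 6150** (`TwoPointDoubling`). [cite: DuminilCopinICM2022, §8.4 p. 29] -/
theorem crux_iff_doubling_of_zoomMonotone (hZM : MonotoneRG.ZoomMonotone) :
    HyperoctahedralRP.ExistsScaleCovariantLimit ↔ MirrorHoelderCompactness.TwoPointDoubling := by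
  rw [crux_iff_orbitPrecompact_of_zoomMonotone hZM, orbitPrecompact_iff_doubling]

/-- Route `MonotoneRG`'s own copy of the target from its items 6150-twin 5955 and 14454 (the shared decl is the same term). [folklore] -/
theorem monotoneRG_target_of_doubling_zoomMonotone (hD : MirrorHoelderCompactness.TwoPointDoubling)
    (hZM : MonotoneRG.ZoomMonotone) : MonotoneRG.ExistsScaleCovariantLimit :=
  crux_of_doubling_zoomMonotone hD hZM

/-! ## Under item 0634 only the EVEN orders `n ≥ 4` remain -/

/-- **Orders `0`, odd, and `2` are free under the two-point law**: along every mesh sequence `u k → 0⁺` the pinned zoom converges at every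
non-coincident configuration of order `n ≤ 2` or odd `n` (odd critical correlators vanish on `ℤ³`, `m*(β_c) = 0`; order `0` is constant; order `2`
is T2 `stub_pairZoom_tendsto_of_twoPointLaw`). [cite: DuminilCopinICM2022, §8.4 p. 29] -/
theorem lowOrders_of_twoPointLaw (h0634 : IsingEuclidUpgrade.IsingEuclidUpgradeR2RotInvPowerLaw)
    {u : ℕ → ℝ} (hu : Tendsto u atTop (𝓝[>] (0 : ℝ))) {n : ℕ} (hn : n ≤ 2 ∨ Odd n)
    {y : Fin n → EuclideanSpace ℝ (Fin 3)} (hy : y ∈ NonCoincident 3 n) :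
    ∃ L : ℝ, Tendsto (fun k : ℕ => rescaledCorrelator (criticalCorr 3) rhoPin n (u k) y) atTop (𝓝 L) := by
  -- adapted from the skeleton `Lines/Sketch.lean` v10 (lead c4)
  by_cases hodd : Odd n
  · refine ⟨0, tendsto_const_nhds.congr fun k => ?_⟩
    rw [rescaledCorrelator_apply, criticalCorr_eq_zero_of_odd le_rfl hodd, mul_zero]
  have hn2 : n ≤ 2 := hn.resolve_right hodd
  have heven : Even n := Nat.not_odd_iff_even.1 hodd
  obtain ⟨m, rfl⟩ := heven
  rcases Nat.eq_zero_or_pos m with rfl | hm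
  · refine ⟨rescaledCorrelator (criticalCorr 3) rhoPin (0 + 0) (u 0) y, tendsto_const_nhds.congr fun k => ?_⟩
    rw [rescaledCorrelator_apply, rescaledCorrelator_apply, pow_zero, pow_zero]
    congr 2
    funext i
    exact Fin.elim0 i
  · obtain ⟨Δ, c, hc, hG⟩ := h0634
    have hm1 : m = 1 := by omega
    subst hm1
    exact ⟨_, stub_pairZoom_tendsto_of_twoPointLaw Δ c hc hG u hu y hy⟩

/-- **UNDER ITEM 0634 THE CRUX IS S2' ∧ S3' AT EVEN ORDERS `n ≥ 4` ONLY** — the interacting-uniqueness core of the 3D-Ising existence problem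
(cf. crux 1344's residue 6′: uniqueness anchored at an interacting regular cluster point at even orders `≥ 4`). [cite: DuminilCopinICM2022, §8.4 p. 29] -/
theorem crux_iff_evenGeFour_of_twoPointLaw (h0634 : IsingEuclidUpgrade.IsingEuclidUpgradeR2RotInvPowerLaw) :
    HyperoctahedralRP.ExistsScaleCovariantLimit ↔
    ((∀ (n : ℕ), 4 ≤ n → Even n → ∀ (y : Fin n → EuclideanSpace ℝ (Fin 3)), y ∈ NonCoincident 3 n →
      (∀ i j, ∃ z : ℤ, y i j = (z : ℝ)) →
      ∃ L : ℝ, Tendsto (fun k : ℕ => rescaledCorrelator (criticalCorr 3) rhoPin n (((2:ℝ) ^ k)⁻¹) y)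
        atTop (𝓝 L)) ∧
    (∀ (n : ℕ), 4 ≤ n → Even n → ∀ (y : Fin n → EuclideanSpace ℝ (Fin 3)), y ∈ NonCoincident 3 n →
      (∀ i j, ∃ z : ℤ, y i j = (z : ℝ)) →
      ∃ L : ℝ, Tendsto (fun k : ℕ => rescaledCorrelator (criticalCorr 3) rhoPin n (((3:ℝ) ^ k)⁻¹) y)
        atTop (𝓝 L))) := by
  -- adapted from the skeleton `Lines/Sketch.lean` v10 (lead c4)
  rw [crux_iff_dyadicInt_triadicInt_of_twoPointLaw h0634]
  have hsplit : ∀ n : ℕ, (n ≤ 2 ∨ Odd n) ∨ (4 ≤ n ∧ Even n) := by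
    intro n
    rcases Nat.even_or_odd n with he | ho
    · by_cases h2 : n ≤ 2
      · exact Or.inl (Or.inl h2)
      · refine Or.inr ⟨?_, he⟩
        obtain ⟨m, rfl⟩ := he
        omega
    · exact Or.inl (Or.inr ho)
  constructor
  · rintro ⟨h2, h3⟩
    exact ⟨fun n _ _ y hy hyZ => h2 n y hy hyZ, fun n _ _ y hy hyZ => h3 n y hy hyZ⟩
  · rintro ⟨h2, h3⟩
    refine ⟨fun n y hy hyZ => ?_, fun n y hy hyZ => ?_⟩
    · rcases hsplit n with hlow | ⟨h4, he⟩
      · exact lowOrders_of_twoPointLaw h0634 tendsto_dyad hlow hy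
      · exact h2 n h4 he y hy hyZ
    · rcases hsplit n with hlow | ⟨h4, he⟩
      · exact lowOrders_of_twoPointLaw h0634 tendsto_triad_nhdsGT hlow hy
      · exact h3 n h4 he y hy hyZ

/-- **Registered anchor `stub_latticeFormsItemMaps`** — the package: crux ⟺ 5955 ∧ integer-mesh convergence; crux ⟺ 6150 ∧ S2' ∧ S3';
6150 ∧ 14454 ⟹ crux. [cite: DuminilCopinICM2022, §8.4 p. 29] -/
theorem stub_latticeFormsItemMaps :
    (HyperoctahedralRP.ExistsScaleCovariantLimit ↔
      (MonotoneRG.OrbitPrecompact ∧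
      (∀ (n : ℕ) (y : Fin n → EuclideanSpace ℝ (Fin 3)), y ∈ NonCoincident 3 n →
        (∀ i j, ∃ z : ℤ, y i j = (z : ℝ)) →
        ∃ L : ℝ, Tendsto (fun m : ℕ => rescaledCorrelator (criticalCorr 3) rhoPin n (1 / (m:ℝ)) y) atTop (𝓝 L)))) ∧
    (HyperoctahedralRP.ExistsScaleCovariantLimit ↔
      (MirrorHoelderCompactness.TwoPointDoubling ∧
      (∀ (n : ℕ) (y : Fin n → EuclideanSpace ℝ (Fin 3)), y ∈ NonCoincident 3 n →
        (∀ i j, ∃ z : ℤ, y i j = (z : ℝ)) →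
        ∃ L : ℝ, Tendsto (fun k : ℕ => rescaledCorrelator (criticalCorr 3) rhoPin n (((2:ℝ) ^ k)⁻¹) y)
          atTop (𝓝 L)) ∧
      (∀ (n : ℕ) (y : Fin n → EuclideanSpace ℝ (Fin 3)), y ∈ NonCoincident 3 n →
        (∀ i j, ∃ z : ℤ, y i j = (z : ℝ)) →
        ∃ L : ℝ, Tendsto (fun k : ℕ => rescaledCorrelator (criticalCorr 3) rhoPin n (((3:ℝ) ^ k)⁻¹) y)
          atTop (𝓝 L)))) ∧
    (MirrorHoelderCompactness.TwoPointDoubling → MonotoneRG.ZoomMonotone → HyperoctahedralRP.ExistsScaleCovariantLimit) :=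
  ⟨crux_iff_orbitPrecompact_intMeshConvergence, crux_iff_doubling_dyadicInt_triadicInt, crux_of_doubling_zoomMonotone⟩

end Summit.CriticalPhenomena.Ising3DConformalLimit.Cruxes.ExistsScaleCovariantLimit.TwoHierarchies.ItemMaps

end
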